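import Summits.BirchSwinnertonDyer.BirchSwinnertonDyer.Theorems.ClassRecordThreeCornerAtThreeShimuraWalkDefs
import Literature.NumberTheory.EllipticCurves.HeegnerPointsKolyvaginPrimaryClassesProofs
import Mathlib.FieldTheory.Galois.Infinite
import HarnessLib

/-!
# Galois descent `E(K̄)^{Gal(K̄/K[m])} = E(emb)(E(K[m]))` for an EMBEDDED ring-class level, and McCallum Cor. 4.5 BOTH WAYS for carrier-style
# Kolyvagin classes — the input of the dictionary entries hκ0 ∕ hκt of the Jetchev-walk engines for the labelled CM family
# (cell `bsd-stepL`, seat `bsd-stepL-corner3-p2` g7 = WIDTH-LEVER lane B; `--supports stmt-BirchSwinnertonDyer-21420 --as helper`)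

WHY (PORT-SPEC §3b, HOME/corner3/g7/CORNER3-G7.md). The re-issued carrier `hpointsRk_of_shimuraLabels_of_noTorsion_walk` (`…ShimuraCarrierOfNoTorsionWalk`)
exposes, at every admissible level `m`, that its subgroup `A m ⊆ E(K̄)` IS the image of `E(K[m])` under the package's `K`-embedding `emb m : K[m] →ₐ[K] K̄`.
With that, the «only if» half of McCallum Cor. 4.5 ∕ Gross Prop. 4.7 (1) (`c(P) = 0 ⟹ P ∈ p^k A`) — which the tree's `kolyvaginClass_eq_zero_iff` gives
under «the points fixed by `Gal(K̄/emb(K[m]))` lie in `A`» — becomes available for the labelled classes. THIS FILE: (i) `mem_range_map_of_forall_smul_eq`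
— Galois descent along a `K`-algebra embedding `e : K[m] →ₐ[K] K̄` of a ring-class level (infinite Galois correspondence + coordinates; proof = the
X₀(N)-datum twin `KolyvaginFamilyData.mem_pointsSubgroup_of_forall_smul_eq` of tam3∕koly with `d.emb ↦ e`); (ii) `smul_eq_of_map_eq_of_forall_apply_eq` — the
converse inclusion (coordinates); (iii) `kolyvaginClass_eq_zero_iff_exists_mem_range` — McCallum Cor. 4.5 both ways for the class of a point of
`A = E(e)(E(K[m]))`. HONEST FRAMING: theorems only (no definition, no named fact, no `sorry`); Galois∕Kummer bookkeeping; nothing about any curve;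
no stub closes; BSD is not proved by any of this; T7. References: [cite: McCallumLMS1991, §4 Cor. 4.5] [cite: GrossLMS1991, §4 Prop. 4.7 (1)]
[cite: SilvermanAEC2009, VIII.§1].
-/

set_option autoImplicit false
set_option linter.dupNamespace false

noncomputable section

open scoped Classical

open WeierstrassCurve Field NumberField Literature.NumberTheory.EllipticCurves Literature.NumberTheory.EllipticCurves.KolyvaginCocycle
  Literature.NumberTheory.GaloisRepresentations Literature.NumberTheory.EllipticCurves.RingClassField

namespace Summit.BirchSwinnertonDyer.BirchSwinnertonDyer.Theorems.ShimuraWalk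

variable {K : Type} [Field K] [NumberField K] {W : WeierstrassCurve ℚ} {ι : K →+* ℂ} {m : ℕ}

/-- An element of `Γ_K` fixing `e(K[m]) ⊆ K̄` pointwise fixes every point of `E(e)(E(K[m])) ⊆ E(K̄)` (coordinates); stated for a point
`v ∈ E(K̄)` GIVEN as the image of `P₀ ∈ E(K[m])` (so that the `Γ_K`-action is read on `geomPoints`). [cite: SilvermanAEC2009, VIII.§1] -/
theorem smul_eq_of_map_eq_of_forall_apply_eq (e : ringClassField K ι m →ₐ[K] AlgebraicClosure K)
    (P₀ : (W.baseChange (ringClassField K ι m)).toAffine.Point) (g : absoluteGaloisGroup K)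
    (hg : ∀ x : ringClassField K ι m, (show AlgebraicClosure K ≃ₐ[K] AlgebraicClosure K from g) (e x) = e x)
    (v : geomPoints (W.baseChange K))
    (hv : (Affine.Point.map (W' := W) e.toRingHom.toRatAlgHom :
      (W.baseChange (ringClassField K ι m)).toAffine.Point →+ geomPoints (W.baseChange K)) P₀ = v) :
    g • v = v := by
  subst hv
  rcases P₀ with _ | ⟨x, y, hxy⟩
  · rfl
  · have hns1 : ((W.baseChange K).baseChange (AlgebraicClosure K)).toAffine.Nonsingular (e x) (e y) :=
      (Affine.baseChange_nonsingular W e.toRingHom.toRatAlgHom.injective x y).mpr hxy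
    change Affine.Point.map (W' := W.baseChange K)
        ((show AlgebraicClosure K ≃ₐ[K] AlgebraicClosure K from g) : AlgebraicClosure K →ₐ[K] AlgebraicClosure K)
        (Affine.Point.some (e x) (e y) hns1) = Affine.Point.some (e x) (e y) hns1
    rw [Affine.Point.map_some]
    simp only [Affine.Point.some.injEq, AlgEquiv.coe_toAlgHom]
    exact ⟨hg x, hg y⟩

/-- **Galois descent `E(K̄)^{Gal(K̄/e(K[m]))} = E(e)(E(K[m]))`** along a `K`-algebra embedding of a ring-class level (infinite Galois
correspondence for `K̄/K` and coordinates). [cite: SilvermanAEC2009, VIII.§1] [cite: GrossLMS1991, proof of Prop. 4.7 (1)] -/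
theorem mem_range_map_of_forall_smul_eq (e : ringClassField K ι m →ₐ[K] AlgebraicClosure K)
    (v : geomPoints (W.baseChange K))
    (hv : ∀ g ∈ {g : absoluteGaloisGroup K | ∀ x : ringClassField K ι m,
        (show AlgebraicClosure K ≃ₐ[K] AlgebraicClosure K from g) (e x) = e x}, g • v = v) :
    v ∈ (Affine.Point.map (W' := W) e.toRingHom.toRatAlgHom :
      (W.baseChange (ringClassField K ι m)).toAffine.Point →+ geomPoints (W.baseChange K)).range := by
  haveI : IsGalois K (AlgebraicClosure K) := {}
  set L : IntermediateField K (AlgebraicClosure K) := e.fieldRange with hL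
  have hmemL : ∀ z : AlgebraicClosure K, z ∈ L ↔ ∃ x : ringClassField K ι m, e x = z := by
    intro z
    rw [hL, AlgHom.mem_fieldRange]
  have hfixing : ∀ g : AlgebraicClosure K ≃ₐ[K] AlgebraicClosure K, g ∈ L.fixingSubgroup →
      ∀ x : ringClassField K ι m, g (e x) = e x := by
    intro g hg x
    rw [IntermediateField.mem_fixingSubgroup_iff] at hg
    exact hg _ ((hmemL _).mpr ⟨x, rfl⟩)
  have hcoord : ∀ z : AlgebraicClosure K,
      (∀ g : AlgebraicClosure K ≃ₐ[K] AlgebraicClosure K, g ∈ L.fixingSubgroup → g z = z) →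
      ∃ x : ringClassField K ι m, e x = z := by
    intro z hz
    rw [← hmemL, ← InfiniteGalois.fixedField_fixingSubgroup L, IntermediateField.mem_fixedField_iff]
    exact fun g hg ↦ hz g hg
  rcases v with _ | ⟨vx, vy, hv0⟩
  · exact AddSubgroup.zero_mem _
  · have hxy : ∀ g : AlgebraicClosure K ≃ₐ[K] AlgebraicClosure K, g ∈ L.fixingSubgroup →
        g vx = vx ∧ g vy = vy := by
      intro g hg
      have h := hv g (hfixing g hg)
      change Affine.Point.map (W' := W.baseChange K) (g : AlgebraicClosure K →ₐ[K] AlgebraicClosure K)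
          (Affine.Point.some vx vy hv0) = Affine.Point.some vx vy hv0 at h
      rw [Affine.Point.map_some] at h
      simpa only [Affine.Point.some.injEq, AlgEquiv.coe_toAlgHom] using h
    obtain ⟨x, hx⟩ := hcoord vx fun g hg ↦ (hxy g hg).1
    obtain ⟨y, hy⟩ := hcoord vy fun g hg ↦ (hxy g hg).2
    subst hx hy
    have hxy0 : (W.baseChange (ringClassField K ι m)).toAffine.Nonsingular x y :=
      (Affine.baseChange_nonsingular W e.toRingHom.toRatAlgHom.injective x y).mp hv0
    refine ⟨Affine.Point.some x y hxy0, ?_⟩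
    change Affine.Point.map (W' := W) e.toRingHom.toRatAlgHom (Affine.Point.some x y hxy0) = _
    rw [Affine.Point.map_some]
    rfl

/-- **McCallum Cor. 4.5 ∕ Gross Prop. 4.7 (1), BOTH WAYS, for the class of a point of `A = E(e)(E(K[m]))`**: `c_n(P) = 0 ⟺ P ∈ n·A`
(the tree's `kolyvaginClass_eq_zero_iff` with the descent above; `N := {g ∣ g fixes e(K[m])}` fixes `P ∈ A`). For the labelled Shimura
classes of `hpointsRk_of_shimuraLabels_of_noTorsion_walk` (clause «`A m = E(emb m)(E(K[m]))`»). [cite: McCallumLMS1991, Cor. 4.5] [cite: GrossLMS1991, Prop. 4.7 (1)] -/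
theorem kolyvaginClass_eq_zero_iff_exists_mem_range (e : ringClassField K ι m →ₐ[K] AlgebraicClosure K) {n : ℤ}
    {hdiv : ∀ P : geomPoints (W.baseChange K), ∃ Q : geomPoints (W.baseChange K), n • Q = P}
    {A : AddSubgroup (geomPoints (W.baseChange K))}
    (hAe : A = (Affine.Point.map (W' := W) e.toRingHom.toRatAlgHom :
      (W.baseChange (ringClassField K ι m)).toAffine.Point →+ geomPoints (W.baseChange K)).range)
    (hA : IsAdmissible (absoluteGaloisGroup K) A n)
    {P : geomPoints (W.baseChange K)} (hP : P ∈ invPoints (absoluteGaloisGroup K) A n) :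
    kolyvaginClass (W.baseChange K) n hdiv hA P hP = 0 ↔ ∃ B ∈ A, n • B = P := by
  have hPA : P ∈ A := hP.1
  obtain ⟨P₀, hP₀⟩ : P ∈ (Affine.Point.map (W' := W) e.toRingHom.toRatAlgHom :
      (W.baseChange (ringClassField K ι m)).toAffine.Point →+ geomPoints (W.baseChange K)).range := hAe ▸ hPA
  refine kolyvaginClass_eq_zero_iff hA hP
    (N := {g : absoluteGaloisGroup K | ∀ x : ringClassField K ι m,
      (show AlgebraicClosure K ≃ₐ[K] AlgebraicClosure K from g) (e x) = e x}) (fun g hg ↦ ?_) (fun v hv ↦ ?_)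
  · exact smul_eq_of_map_eq_of_forall_apply_eq e P₀ g hg P hP₀
  · rw [hAe]
    exact mem_range_map_of_forall_smul_eq e v hv

end Summit.BirchSwinnertonDyer.BirchSwinnertonDyer.Theorems.ShimuraWalk

end
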